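import Summits.Ventures.Crystal3D.Theorems.StickyWulffConstantCoaxialWallLawUpCount
import Summits.Ventures.Crystal3D.Theorems.StickyWulffConstantGenericWallFloorSealing
import Summits.Ventures.Crystal3D.Theorems.StickyWulffConstantGenericWallFloorSiteLedger
import HarnessLib

/-!
# The grain lemma of the terrace/riser ledger: a clamped grain pays its outer face plus `(√6/4)·sin θ`

HONEST FRAMING. Part of the venture `Summits/Ventures/Crystal3D` (cell `crystal3d-full`), helper
`--supports` the crux `CoaxialWallLaw` (stmt-Ventures-19481, `route-Ventures-StickyWulffConstant`),
REGISTERED line `WallLedgerF` (planner cf-p1 gen 16), stub `stub_coaxialTwoSlabAdhesion`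
(terrace/riser slot ledger, RIGID rung).  Rung credit only.  The F-line analogue of
`grain_ledger_ge` (`…GenericWallFloorGrainLedger`, line `WallLedgerG`), with the inner credit
`+1·πρ²` of the steepest class replaced by `¼` per CLIMBING IN-PLANE vacancy and the local
non-saturation hypothesis replaced by the crude ABSORPTION inequality of the F-line
(`vac_in(x) + 4·deg(x) ≤ 48`, landed for twin / translation / non-co-axial partners in
`…CoaxialWallLawTwinAbsorptionMoved`, `…TranslateAbsorption`, `…NonCoaxialAbsorption`); no
clean-sliver hypothesis is needed (the floor is sealed by `sealing_below`).

SETTING (bottom half of the cell of `CoaxialTwoSlabAdhesion`): a `1`-separated `X` in the cylinder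
`{−2R₀ ≤ x₂ ≤ h + 2R₀, x₀² + x₁² ≤ ρ²}`, the grain `Λ = A·Λ₀ + t` with its clamped slab
`P = Λ ∩ {−2R₀ ≤ x₂ ≤ −R₀, disc ρ} ⊆ X`, the other grain `Λ₂ = A₂·Λ₀ + t₂` (disjoint from `Λ`) with
its clamped slab `Λ₂ ∩ {h + R₀ ≤ x₂ ≤ h + 2R₀, disc ρ}` inside `X`, `3 ≤ R₀ ≤ ρ`.

* `two_R₀_add_one_le_of_foreign` — a non-rim ball of `P` touching a foreign ball lies at height
  `≥ −2R₀ + 1` (`sealing_below`: the floor layer of the cell touches nothing foreign).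
* `add_slot_mem_sample_of_high` — such a ball keeps all its down/sideways slot sites inside `P`:
  a ball with a foreign contact carries NO outer credit.
* `coaxial_ball_ledger` — the per-ball inequality at a non-rim grain ball `x`:
  `4·#{outer credits of x} + #{climbing in-plane vacancies of x} ≤ 4·(12 − deg x)`.
* `coaxial_grain_ledger_ge` — summed, with `outerCredits_ge` (`2φ πρ²` outer credits) and the
  climbing riser count `upInPlane_vacancies_ge_sine` (`√6 sin θ · πρ²` climbing in-plane vacancies):

  `Σ_{x ∈ X ∩ Λ} (12 − deg_X x) ≥ (2 φ(A⁻¹e₃) + (√6/4) √(1 − ⟪A e₃, e₃⟫²)) π ρ² − C(R₀) (1 + h) ρ`,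
  `φ = (√2/4) Σ_{w ∈ fccSlots} |⟪A w, e₃⟫|`, `C(R₀) = 120√2π + (3/4)√2π(6R₀+16) + 720(4R₀+2)`.

WHAT THIS IS NOT: the top grain (mirror, next file), the two-grain assembly, the stub; the
absorption inequality is an HYPOTHESIS here (discharged pair by pair in the assembly); rung F-C1
not moved.
-/

noncomputable section

namespace Summit.Ventures.Crystal3D.Theorems

open Summit.Ventures.Crystal3D Finset
open Literature.MathematicalPhysics.StatisticalMechanics (fccStacking)
open scoped InnerProductSpace

/-- **The floor layer touches nothing foreign.**  A non-rim point `x` (lateral radius `≤ ρ − 2`)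
with a foreign contact `q ∈ X \ Λ`, `dist x q = 1`, has `−2R₀ + 1 ≤ x₂` (`R₀ ≥ 3`; `sealing_below`). -/
theorem two_R₀_add_one_le_of_foreign
    (A : EuclideanSpace ℝ (Fin 3) ≃ₗᵢ[ℝ] EuclideanSpace ℝ (Fin 3)) (t : EuclideanSpace ℝ (Fin 3))
    (X P : Finset (EuclideanSpace ℝ (Fin 3))) (R₀ h ρ : ℝ) (hR₀ : 3 ≤ R₀) (hρ : R₀ ≤ ρ)
    (hX : ∀ p ∈ X, ∀ q ∈ X, p ≠ q → 1 ≤ dist p q)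
    (hcell : ∀ p ∈ X, -(2 * R₀) ≤ p 2 ∧ p 2 ≤ h + 2 * R₀ ∧ p 0 ^ 2 + p 1 ^ 2 ≤ ρ ^ 2)
    (hPX : P ⊆ X)
    (hP : ∀ p, p ∈ P ↔ (p ∈ (fun q => A q + t) '' fccStacking 1 (Real.sqrt (2 / 3)) ∧
      -(2 * R₀) ≤ p 2 ∧ p 2 ≤ -R₀ ∧ p 0 ^ 2 + p 1 ^ 2 ≤ ρ ^ 2))
    {x q : EuclideanSpace ℝ (Fin 3)} (hxrim : x 0 ^ 2 + x 1 ^ 2 ≤ (ρ - 2) ^ 2)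
    (hqX : q ∈ X) (hqΛ : q ∉ (fun q => A q + t) '' fccStacking 1 (Real.sqrt (2 / 3)))
    (hxq : dist x q = 1) : -(2 * R₀) + 1 ≤ x 2 := by
  by_contra hlow
  push Not at hlow
  have hρ1 : (1 : ℝ) ≤ ρ := by linarith
  have hqP : q ∉ P := fun hqP => hqΛ ((hP q).1 hqP).1
  have hz : |q 2 - x 2| ≤ 1 := by
    have := abs_apply_sub_le_dist q x 2
    rwa [dist_comm, hxq] at this
  have hqz := (abs_le.1 hz).2
  have hlat : q 0 ^ 2 + q 1 ^ 2 ≤ (ρ - 1) ^ 2 := by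
    have := lateral_sq_le_of_dist_le_one (y := q) (q := x) (r := ρ - 2) (by linarith) hxrim
      (by rw [dist_comm, hxq])
    have e : ρ - 2 + 1 = ρ - 1 := by ring
    rwa [e] at this
  exact sealing_below A t (-(2 * R₀)) (-R₀) ρ hρ1 X P hX hPX hP q hqX hqP (hcell q hqX).1
    (by linarith) hlat

/-- **A high non-rim sample ball keeps its down/sideways slot sites in the sample.**  If `x ∈ P`
has lateral radius `≤ ρ − 2` and height `≥ −2R₀ + 1`, then `x + A w ∈ P` for every slot `w` with
`⟪A w, e₃⟫ ≤ 0` (`R₀ ≥ 3`). -/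
theorem add_slot_mem_sample_of_high
    (A : EuclideanSpace ℝ (Fin 3) ≃ₗᵢ[ℝ] EuclideanSpace ℝ (Fin 3)) (t : EuclideanSpace ℝ (Fin 3))
    (P : Finset (EuclideanSpace ℝ (Fin 3))) (R₀ ρ : ℝ) (hR₀ : 3 ≤ R₀) (hρ : R₀ ≤ ρ)
    (hP : ∀ p, p ∈ P ↔ (p ∈ (fun q => A q + t) '' fccStacking 1 (Real.sqrt (2 / 3)) ∧
      -(2 * R₀) ≤ p 2 ∧ p 2 ≤ -R₀ ∧ p 0 ^ 2 + p 1 ^ 2 ≤ ρ ^ 2))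
    {x : EuclideanSpace ℝ (Fin 3)} (hx : x ∈ P) (hxrim : x 0 ^ 2 + x 1 ^ 2 ≤ (ρ - 2) ^ 2)
    (hhigh : -(2 * R₀) + 1 ≤ x 2)
    {w : EuclideanSpace ℝ (Fin 3)} (hw : w ∈ fccSlots)
    (hα : ⟪A w, EuclideanSpace.single (2 : Fin 3) (1 : ℝ)⟫_ℝ ≤ 0) : x + A w ∈ P := by
  have hρ2 : (0 : ℝ) ≤ ρ - 2 := by linarith
  obtain ⟨hxΛ, hx1, hx2, hx3⟩ := (hP x).1 hx
  have hsp : Real.sqrt (x 0 ^ 2 + x 1 ^ 2) ≤ ρ - 2 := by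
    rw [← Real.sqrt_sq hρ2]; exact Real.sqrt_le_sqrt hxrim
  have hlatw : (x + A w) 0 ^ 2 + (x + A w) 1 ^ 2 ≤ ρ ^ 2 := by
    have h1 := sqrt_lateral_add_le x (A w)
    rw [LinearIsometryEquiv.norm_map, norm_eq_one_of_mem_fccSlots hw] at h1
    have h2 : Real.sqrt ((x + A w) 0 ^ 2 + (x + A w) 1 ^ 2) ≤ ρ := by linarith
    have h3 := Real.sq_sqrt (by positivity : (0 : ℝ) ≤ (x + A w) 0 ^ 2 + (x + A w) 1 ^ 2)
    nlinarith [Real.sqrt_nonneg ((x + A w) 0 ^ 2 + (x + A w) 1 ^ 2)]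
  have hα1 : -1 ≤ ⟪A w, EuclideanSpace.single (2 : Fin 3) (1 : ℝ)⟫_ℝ :=
    (abs_le.1 (abs_inner_slot_le_one A hw)).1
  have e2 := apply_two_add_eq_inner x (A w)
  rw [hP]
  refine ⟨movedFcc_add_site_mem A t hxΛ (mem_fcc_of_mem_fccSlots hw), ?_, ?_, hlatw⟩
  · rw [e2]; linarith
  · rw [e2]; linarith

open scoped Classical in
/-- **The per-ball inequality of the terrace/riser ledger.**  In the setting of the module
docstring, at a NON-RIM grain ball `x ∈ X ∩ Λ` satisfying the absorption inequality
`#{w : w₂ = 0, x + A w ∉ X} + 4·deg x ≤ 48`: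
`4 · #{down-slots w : x ∈ P, x + A w ∉ P} + #{w : w₂ = 0, x + A w ∉ X, x₂ < (x + A w)₂} ≤ 4 · (12 − deg x)`. -/
theorem coaxial_ball_ledger
    (A : EuclideanSpace ℝ (Fin 3) ≃ₗᵢ[ℝ] EuclideanSpace ℝ (Fin 3)) (t : EuclideanSpace ℝ (Fin 3))
    (X P : Finset (EuclideanSpace ℝ (Fin 3))) (R₀ h ρ : ℝ) (hR₀ : 3 ≤ R₀) (hρ : R₀ ≤ ρ)
    (hX : ∀ p ∈ X, ∀ q ∈ X, p ≠ q → 1 ≤ dist p q)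
    (hcell : ∀ p ∈ X, -(2 * R₀) ≤ p 2 ∧ p 2 ≤ h + 2 * R₀ ∧ p 0 ^ 2 + p 1 ^ 2 ≤ ρ ^ 2)
    (hPX : P ⊆ X)
    (hP : ∀ p, p ∈ P ↔ (p ∈ (fun q => A q + t) '' fccStacking 1 (Real.sqrt (2 / 3)) ∧
      -(2 * R₀) ≤ p 2 ∧ p 2 ≤ -R₀ ∧ p 0 ^ 2 + p 1 ^ 2 ≤ ρ ^ 2))
    {x : EuclideanSpace ℝ (Fin 3)}
    (hxΛ : x ∈ (fun q => A q + t) '' fccStacking 1 (Real.sqrt (2 / 3)))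
    (hxrim : x 0 ^ 2 + x 1 ^ 2 ≤ (ρ - 2) ^ 2)
    (habs : (fccSlots.filter fun w => w 2 = 0 ∧ x + A w ∉ X).card +
      4 * (X.filter fun q => dist x q = 1).card ≤ 48) :
    4 * ((fccSlots.filter fun w => ⟪A w, EuclideanSpace.single (2 : Fin 3) (1 : ℝ)⟫_ℝ < 0).filter
        fun w => x ∈ P.filter (fun p => p + A w ∉ P)).card +
      (fccSlots.filter fun w => w 2 = 0 ∧ (x + A w ∉ X ∧ x 2 < (x + A w) 2)).card ≤
      4 * (12 - (X.filter fun q => dist x q = 1).card) := by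
  classical
  set e₃ : EuclideanSpace ℝ (Fin 3) := EuclideanSpace.single (2 : Fin 3) (1 : ℝ) with he₃
  set Λ : Set (EuclideanSpace ℝ (Fin 3)) := (fun q => A q + t) '' fccStacking 1 (Real.sqrt (2 / 3)) with hΛ
  set Down : Finset (EuclideanSpace ℝ (Fin 3)) := fccSlots.filter (fun w => ⟪A w, e₃⟫_ℝ < 0) with hDown
  set Oc : Finset (EuclideanSpace ℝ (Fin 3)) := Down.filter fun w => x ∈ P.filter (fun p => p + A w ∉ P) with hOc
  set U : Finset (EuclideanSpace ℝ (Fin 3)) :=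
    fccSlots.filter fun w => w 2 = 0 ∧ (x + A w ∉ X ∧ x 2 < (x + A w) 2) with hU
  have hdeg12 : (X.filter fun q => dist x q = 1).card ≤ 12 := card_filter_dist_eq_one_le_twelve X hX x
  have hUle : U.card ≤ (fccSlots.filter fun w => w 2 = 0 ∧ x + A w ∉ X).card :=
    card_le_card (fun w hw => by
      rw [mem_filter] at hw ⊢
      exact ⟨hw.1, hw.2.1, hw.2.2.1⟩)
  by_cases hfor : ∃ q ∈ X, q ∉ Λ ∧ dist x q = 1
  · -- a foreign contact: no outer credit (sealing), the climbing in-plane vacancies are absorbed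
    obtain ⟨q, hqX, hqΛ, hxq⟩ := hfor
    have hOc0 : Oc = ∅ := by
      rw [Finset.eq_empty_iff_forall_notMem]
      intro w hw
      rw [hOc, mem_filter] at hw
      obtain ⟨hwD, hxO⟩ := hw
      rw [hDown, mem_filter] at hwD
      rw [mem_filter] at hxO
      obtain ⟨hxP, hnot⟩ := hxO
      have hhigh := two_R₀_add_one_le_of_foreign A t X P R₀ h ρ hR₀ hρ hX hcell hPX hP hxrim hqX
        hqΛ hxq
      exact hnot (add_slot_mem_sample_of_high A t P R₀ ρ hR₀ hρ hP hxP hxrim hhigh hwD.1 hwD.2.le)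
    rw [hOc0, card_empty, mul_zero, zero_add]
    omega
  · -- no foreign contact: `12 − deg = #empty slots ≥` the credited slots
    push Not at hfor
    have hc0 : (X.filter fun q => dist x q = 1 ∧ q ∉ Λ).card = 0 := by
      rw [Finset.card_eq_zero, Finset.eq_empty_iff_forall_notMem]
      intro q hq
      rw [mem_filter] at hq
      exact hfor q hq.1 hq.2.2 hq.2.1
    have hled := twelve_sub_degree_eq A t x X hxΛ
    rw [hc0] at hled
    -- credited slots are empty in `X`, and the two kinds are disjoint
    have hOcsub : Oc ⊆ fccSlots.filter fun w => x + A w ∉ X := by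
      intro w hw
      rw [hOc, mem_filter] at hw
      obtain ⟨hwD, hxO⟩ := hw
      rw [hDown, mem_filter] at hwD
      rw [mem_filter] at hxO
      rw [mem_filter]
      exact ⟨hwD.1, outerSlot_not_mem A t X P R₀ h ρ hcell hP (mem_fcc_of_mem_fccSlots hwD.1) hwD.2.le
        hxO.1 hxO.2⟩
    have hUsub : U ⊆ fccSlots.filter fun w => x + A w ∉ X := by
      intro w hw
      rw [hU, mem_filter] at hw
      rw [mem_filter]
      exact ⟨hw.1, hw.2.2.1⟩
    have hdj : Disjoint Oc U := by
      rw [Finset.disjoint_left]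
      intro w hwO hwU
      rw [hOc, mem_filter] at hwO
      rw [hDown, mem_filter] at hwO
      rw [hU, mem_filter] at hwU
      have h1 : ⟪A w, e₃⟫_ℝ < 0 := hwO.1.2
      have h2 : x 2 < (x + A w) 2 := hwU.2.2.2
      rw [apply_two_add_eq_inner] at h2
      linarith
    have hle : Oc.card + U.card ≤ (fccSlots.filter fun w => x + A w ∉ X).card := by
      rw [← card_union_of_disjoint hdj]
      exact card_le_card (union_subset hOcsub hUsub)
    have h12 : (fccSlots.filter fun w => x + A w ∉ X).card ≤ 12 :=
      (card_filter_le _ _).trans (by rw [card_fccSlots])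
    omega

open scoped Classical in
/-- **The grain lemma of the terrace/riser ledger (bottom grain).**  See the module docstring. -/
theorem coaxial_grain_ledger_ge
    (A : EuclideanSpace ℝ (Fin 3) ≃ₗᵢ[ℝ] EuclideanSpace ℝ (Fin 3)) (t : EuclideanSpace ℝ (Fin 3))
    (A₂ : EuclideanSpace ℝ (Fin 3) ≃ₗᵢ[ℝ] EuclideanSpace ℝ (Fin 3)) (t₂ : EuclideanSpace ℝ (Fin 3))
    (X P : Finset (EuclideanSpace ℝ (Fin 3))) (R₀ h ρ : ℝ) (hR₀ : 3 ≤ R₀) (hh : 0 ≤ h) (hρ : R₀ ≤ ρ)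
    (hX : ∀ p ∈ X, ∀ q ∈ X, p ≠ q → 1 ≤ dist p q)
    (hcell : ∀ p ∈ X, -(2 * R₀) ≤ p 2 ∧ p 2 ≤ h + 2 * R₀ ∧ p 0 ^ 2 + p 1 ^ 2 ≤ ρ ^ 2)
    (hPX : P ⊆ X)
    (hP : ∀ p, p ∈ P ↔ (p ∈ (fun q => A q + t) '' fccStacking 1 (Real.sqrt (2 / 3)) ∧
      -(2 * R₀) ≤ p 2 ∧ p 2 ≤ -R₀ ∧ p 0 ^ 2 + p 1 ^ 2 ≤ ρ ^ 2))
    (hP₂ : ∀ p ∈ (fun q => A₂ q + t₂) '' fccStacking 1 (Real.sqrt (2 / 3)),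
      h + R₀ ≤ p 2 → p 2 ≤ h + 2 * R₀ → p 0 ^ 2 + p 1 ^ 2 ≤ ρ ^ 2 → p ∈ X)
    (hdisj : ∀ p ∈ (fun q => A q + t) '' fccStacking 1 (Real.sqrt (2 / 3)),
      p ∉ (fun q => A₂ q + t₂) '' fccStacking 1 (Real.sqrt (2 / 3)))
    (habs : ∀ x ∈ X, x ∈ (fun q => A q + t) '' fccStacking 1 (Real.sqrt (2 / 3)) →
      (fccSlots.filter fun w => w 2 = 0 ∧ x + A w ∉ X).card +
        4 * (X.filter fun q => dist x q = 1).card ≤ 48) :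
    (2 * (Real.sqrt 2 / 4 * ∑ w ∈ fccSlots, |⟪A w, EuclideanSpace.single (2 : Fin 3) (1 : ℝ)⟫_ℝ|) +
        Real.sqrt 6 / 4 * Real.sqrt (1 - ⟪A (EuclideanSpace.single (2 : Fin 3) (1 : ℝ)),
          EuclideanSpace.single (2 : Fin 3) (1 : ℝ)⟫_ℝ ^ 2)) * Real.pi * ρ ^ 2 -
        (120 * Real.sqrt 2 * Real.pi + 3 / 4 * Real.sqrt 2 * Real.pi * (6 * R₀ + 16) +
          720 * (4 * R₀ + 2)) * (1 + h) * ρ ≤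
      ∑ x ∈ X.filter (fun x => x ∈ (fun q => A q + t) '' fccStacking 1 (Real.sqrt (2 / 3))),
        ((12 : ℝ) - ((X.filter fun q => dist x q = 1).card : ℝ)) := by
  classical
  set e₃ : EuclideanSpace ℝ (Fin 3) := EuclideanSpace.single (2 : Fin 3) (1 : ℝ) with he₃
  set Λ : Set (EuclideanSpace ℝ (Fin 3)) := (fun q => A q + t) '' fccStacking 1 (Real.sqrt (2 / 3)) with hΛ
  set X₁ : Finset (EuclideanSpace ℝ (Fin 3)) := X.filter (fun x => x ∈ Λ) with hX₁
  set Down : Finset (EuclideanSpace ℝ (Fin 3)) := fccSlots.filter (fun w => ⟪A w, e₃⟫_ℝ < 0) with hDown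
  set O : EuclideanSpace ℝ (Fin 3) → Finset (EuclideanSpace ℝ (Fin 3)) :=
    fun w => P.filter (fun p => p + A w ∉ P) with hO
  set U : EuclideanSpace ℝ (Fin 3) → ℕ :=
    fun x => (fccSlots.filter fun w => w 2 = 0 ∧ (x + A w ∉ X ∧ x 2 < (x + A w) 2)).card with hU
  set deg : EuclideanSpace ℝ (Fin 3) → ℕ := fun x => (X.filter fun q => dist x q = 1).card with hdeg
  set k : EuclideanSpace ℝ (Fin 3) → ℕ :=
    fun x => 4 * (Down.filter fun w => x ∈ O w).card + U x with hk
  have hρ0 : (0 : ℝ) ≤ ρ := by linarith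
  have hPX₁ : P ⊆ X₁ := by
    intro p hp
    rw [hX₁, mem_filter]
    exact ⟨hPX hp, ((hP p).1 hp).1⟩
  have hX₁X : X₁ ⊆ X := filter_subset _ _
  have hP₁ : ∀ p ∈ Λ, -(2 * R₀) ≤ p 2 → p 2 ≤ -R₀ → p 0 ^ 2 + p 1 ^ 2 ≤ ρ ^ 2 → p ∈ X :=
    fun p hp h1 h2 h3 => hPX ((hP p).2 ⟨hp, h1, h2, h3⟩)
  -- (1) credit counts: outer face and climbing riser count
  have hOut := outerCredits_ge A t P R₀ ρ hR₀ hρ hP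
  have hIn := upInPlane_vacancies_ge_sine A t A₂ t₂ X hX R₀ h ρ hR₀ hh hρ hP₁ hP₂ hdisj
  -- (2) the sum of the credits per ball
  have hk_sum : ∑ x ∈ X₁, (k x : ℝ) = 4 * ∑ w ∈ Down, ((O w).card : ℝ) + ∑ x ∈ X₁, (U x : ℝ) := by
    have hN1 : ∑ x ∈ X₁, (Down.filter fun w => x ∈ O w).card = ∑ w ∈ Down, (O w).card := by
      rw [Finset.sum_congr rfl (fun x _ => Finset.card_filter (fun w => x ∈ O w) Down), Finset.sum_comm]
      refine sum_congr rfl fun w _ => ?_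
      rw [← Finset.card_filter, filter_mem_eq_inter, inter_eq_right.2 ((filter_subset _ _).trans hPX₁)]
    have hN : ∑ x ∈ X₁, k x = 4 * ∑ w ∈ Down, (O w).card + ∑ x ∈ X₁, U x := by
      simp only [hk, sum_add_distrib, ← mul_sum, hN1]
    have := congrArg (Nat.cast : ℕ → ℝ) hN
    push_cast at this
    exact this
  -- (3) per-ball facts
  have hdeg12 : ∀ x, deg x ≤ 12 := fun x => card_filter_dist_eq_one_le_twelve X hX x
  have hk60 : ∀ x, k x ≤ 60 := by
    intro x
    have h1 : (Down.filter fun w => x ∈ O w).card ≤ 12 :=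
      (card_filter_le _ _).trans ((card_filter_le _ _).trans (by rw [card_fccSlots]))
    have h2 : U x ≤ 12 := (card_filter_le _ _).trans (by rw [card_fccSlots])
    simp only [hk]; omega
  have hk_le : ∀ x ∈ X₁, ¬ ((ρ - 2) ^ 2 < x 0 ^ 2 + x 1 ^ 2) → (k x : ℝ) ≤ 4 * (12 - (deg x : ℝ)) := by
    intro x hx hrim
    push Not at hrim
    have hxX : x ∈ X := hX₁X hx
    have hxΛ : x ∈ Λ := (mem_filter.1 hx).2
    have key : k x ≤ 4 * (12 - deg x) := by
      simp only [hk, hdeg, hDown, hO, hU]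
      exact coaxial_ball_ledger A t X P R₀ h ρ hR₀ hρ hX hcell hPX hP hxΛ hrim (habs x hxX hxΛ)
    have h1 : ((k x : ℕ) : ℝ) ≤ ((4 * (12 - deg x) : ℕ) : ℝ) := by exact_mod_cast key
    have h2 : ((4 * (12 - deg x) : ℕ) : ℝ) = 4 * (12 - (deg x : ℝ)) := by
      have := hdeg12 x
      push_cast [Nat.cast_sub this]
      ring
    rw [h2] at h1
    exact h1
  -- (4) the rim count
  have hrim := card_cellRim_le X hX (-(2 * R₀)) (h + 2 * R₀) ρ (by linarith) (by linarith) hcell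
  have hrim' : ((((X.filter fun p => (ρ - 2) ^ 2 < p 0 ^ 2 + p 1 ^ 2).card : ℕ) : ℝ)) ≤
      48 * (4 * R₀ + 2) * (1 + h) * ρ := by
    have e : h + 2 * R₀ - -(2 * R₀) + 2 = h + 4 * R₀ + 2 := by ring
    rw [e] at hrim
    have h1 : h + 4 * R₀ + 2 ≤ (4 * R₀ + 2) * (1 + h) := by nlinarith
    have h3 : (0 : ℝ) ≤ h + 4 * R₀ + 2 := by linarith
    calc _ ≤ 48 * (h + 4 * R₀ + 2) * (ρ - 1) := hrim
      _ ≤ 48 * ((4 * R₀ + 2) * (1 + h)) * ρ := by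
          have : (0 : ℝ) ≤ ρ - 1 := by linarith
          nlinarith
      _ = 48 * (4 * R₀ + 2) * (1 + h) * ρ := by ring
  -- (5) pointwise: `4 (12 − deg x) ≥ k x − 60·[rim x]` on `X₁`
  have hpt : ∀ x ∈ X₁, (k x : ℝ) - 60 * (if (ρ - 2) ^ 2 < x 0 ^ 2 + x 1 ^ 2 then 1 else 0) ≤
      4 * (12 - (deg x : ℝ)) := by
    intro x hx
    split_ifs with hr
    · have h1 : (k x : ℝ) ≤ 60 := by exact_mod_cast hk60 x
      have h2 : (deg x : ℝ) ≤ 12 := by exact_mod_cast hdeg12 x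
      linarith
    · have := hk_le x hx hr; simpa using this
  have hsum := Finset.sum_le_sum hpt
  rw [sum_sub_distrib, ← mul_sum, sum_boole, ← mul_sum] at hsum
  -- the rim balls of X₁ are rim balls of X
  have hrimX₁ : (((X₁.filter fun x => (ρ - 2) ^ 2 < x 0 ^ 2 + x 1 ^ 2).card : ℕ) : ℝ) ≤
      (((X.filter fun p => (ρ - 2) ^ 2 < p 0 ^ 2 + p 1 ^ 2).card : ℕ) : ℝ) := by
    exact_mod_cast card_le_card (filter_subset_filter _ hX₁X)
  rw [hk_sum] at hsum
  -- assemble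
  have hDeg : ∑ x ∈ X₁, ((12 : ℝ) - ((X.filter fun q => dist x q = 1).card : ℝ)) =
      ∑ x ∈ X₁, ((12 : ℝ) - (deg x : ℝ)) := rfl
  rw [hDeg]
  have hIn' : Real.sqrt 6 * Real.sqrt (1 - ⟪A e₃, e₃⟫_ℝ ^ 2) * Real.pi * ρ ^ 2 -
      3 * (Real.sqrt 2 * Real.pi * (6 * R₀ + 16) * (1 + h) * ρ) ≤ ∑ x ∈ X₁, (U x : ℝ) := hIn
  have hpos : 0 ≤ Real.sqrt 2 * Real.pi * h * ρ := by positivity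
  nlinarith [hOut, hIn', hsum, hrimX₁, hrim', hpos]

end Summit.Ventures.Crystal3D.Theorems

end
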